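import Summits.AtomisticToContinuum.HydrodynamicLimit.Theorems.InfluenceLocality.Negative.InfluenceLocalityFalseOfIgnitionTemplates
import Summits.AtomisticToContinuum.HydrodynamicLimit.Theorems.InfluenceLocality.Negative.IgnitionOfScript
import Summits.AtomisticToContinuum.HydrodynamicLimit.Theorems.InfluenceLocality.Negative.ContactPerturbation
import Summits.AtomisticToContinuum.HydrodynamicLimit.Theorems.InfluenceLocality.Negative.ReflectVelPerturbation
import Summits.AtomisticToContinuum.HydrodynamicLimit.Theorems.InfluenceLocality.Negative.PackingOfSeparated
import Summits.AtomisticToContinuum.HydrodynamicLimit.Theorems.InfluenceLocality.Negative.CascadeCollisionAlgebra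
import Summits.AtomisticToContinuum.HydrodynamicLimit.Theorems.InfluenceLocality.Negative.TubeNoContact
import Summits.AtomisticToContinuum.HydrodynamicLimit.Theorems.InfluenceLocality.Negative.TubeInv
import Summits.AtomisticToContinuum.HydrodynamicLimit.Theorems.InfluenceLocality.Negative.TubeOutgoing
import Summits.AtomisticToContinuum.HydrodynamicLimit.Theorems.InfluenceLocality.Negative.TubeNextPhase
import Summits.AtomisticToContinuum.HydrodynamicLimit.Theorems.InfluenceLocality.Negative.TubeProg
import Summits.AtomisticToContinuum.HydrodynamicLimit.Theorems.InfluenceLocality.Negative.ContactLate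
import Summits.AtomisticToContinuum.HydrodynamicLimit.Theorems.InfluenceLocality.Negative.ContactWindow
import Summits.AtomisticToContinuum.HydrodynamicLimit.Theorems.InfluenceLocality.Negative.TorusDistChart
import Summits.AtomisticToContinuum.HydrodynamicLimit.Theorems.InfluenceLocality.Negative.BushSeparation
import Literature.Analysis.FluidPDE.HardSphereTorusMeasure
import HarnessLib

/-!
# Skeleton (lead c4, rev 6; c3 rev 4 + bush architecture) of the refutation line `ignition-cascade-refutation`,
# crux `InfluenceLocality` (stmt-AtomisticToContinuum-13916): PHASE 2, `IgnitionTemplates`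

Phase 1 is landed: `InfluenceLocality_false_of_IgnitionTemplates : IgnitionTemplates → ¬ InfluenceLocality`
(Negative/InfluenceLocalityFalseOfIgnitionTemplates.lean, p125432). This skeleton organises the construction of
`IgnitionTemplates`. Landed inputs (all `--supports stmt-AtomisticToContinuum-13916`): `stub_torusIsolatedPair` (p129457),
`stub_contactPerturbation` (p130085), `stub_reflectVelPerturbation` (p129694), `stub_packingOfSeparated` (p129860),
`stub_phaseTracking` (p134191, objects p132247+p133449), the bridge `ignition_of_script` (p138265), the tube lemmas
`stub_tubeEnclosure` (p139818) and `stub_tubeNoContact` (p140127).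

Revision 5 (lead c4, 2026-08-17): architecture = FREE LATTICE X/D IFS TOP TREE + BUSH LEAVES
(Cruxes/InfluenceLocality/Lines/ignition-cascade-refutation-c4.md): no synchrony, no cube territories; the top tree's
all-depth disjointness is certified by a finite neighbour automaton (work in progress, kit j024370/1/494/5), the leaves
are sparse 45°-trees whose clearance is the elementary ball-nesting lemma `stub_bushSeparation` (new registered stub,
design-independent). The assembly stub consumes it together with the tube calculus.

Revision 4 (2026-08-17, cycle 2). The phase sets of the script are TIME-WINDOWED FREE-FLIGHT TUBES
`{(t, x, v) | ts ≤ t ∧ ‖v - v₀‖ ≤ δv ∧ euclidDist (x + proj ((t₀ - t) • v)) x₀ ≤ δx}` (the window `ts ≤ t` removes the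
phantom incoming contact of the two post-event tubes of a designed split at time `t₀ - √2 ε / v`, which would violate
`TrackValid.sep`). The design-independent TUBE CALCULUS that turns nominal inequalities into the fields of
`PhaseScript.TrackValid` is split into five registered stubs (`stub_tubeInv`, `stub_tubeOutgoing`, `stub_tubeNextPhase`,
`stub_tubeProg`, `stub_contactLate` below, each a closed first-order statement about `T3`/`V3` vectors), consumed
by the assembly stub `stub_ignitionTemplates_assembly` together with the DESIGN (lead): a ratio-8 lattice cascade
generator under the 2-adic window discipline (Cruxes/InfluenceLocality/Lines/ignition-cascade-refutation-c3.md §4):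
13 coplanarity functionals, node rule `v₂ ≤ 5`, fresh outputs, synchrony by equal weighted path lengths, clearance
certificate = one separating functional per same/adjacent-level pair, cross-level pairs immune by valuation.
-/

namespace Summit.AtomisticToContinuum.HydrodynamicLimit.Theorems.InfluenceLocality.Negative

open MeasureTheory Set
open scoped InnerProductSpace
open Literature.Analysis.FluidPDE Literature.MathematicalPhysics.KineticTheory
open Literature.Analysis.FunctionSpaces
open Summit.AtomisticToContinuum.HydrodynamicLimit.Theses.AntiMazurCoboundaries (InfluenceLocality)

noncomputable section

/-! ## The tube calculus (T1)–(T5): ALL LANDED (wave 2, 2026-08-17) -/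

/-! (T1) `stub_tubeInv` LANDED: Negative/TubeInv.lean (p142574), imported. -/

/-! (T2) `stub_tubeOutgoing` LANDED: Negative/TubeOutgoing.lean (p142656), imported. -/

/-! (T3) `stub_tubeNextPhase` LANDED: Negative/TubeNextPhase.lean (p142575), imported. -/

/-! (T4) `stub_tubeProg` LANDED: Negative/TubeProg.lean (p142614), imported. -/

/-! (T5) `stub_contactLate` LANDED: Negative/ContactLate.lean (p142916), imported. -/

/-! ## Wave 3 (T6), (T8): LANDED -/

/-! (T6) `stub_contactWindow` LANDED: Negative/ContactWindow.lean (p144165). -/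

/-! (T8) `stub_torusDistChart` LANDED: Negative/TorusDistChart.lean (p144138). -/

/-! ## (B1) Bush geometry: `stub_bushSeparation` LANDED (Negative/BushObjects.lean p152563, Negative/BushSeparation.lean
p152759, worker of lead c4), imported. -/

/-- STUB (ASSEMBLY = the DESIGN, lead). rev 5: the free lattice X/D IFS top tree with its neighbour-automaton
certificate and bush leaves (Lines/ignition-cascade-refutation-c4.md §3; formerly the ratio-8 lattice generator of
Lines/ignition-cascade-refutation-c3.md §4), the recursive template (nominal positions/velocities/tolerances of
`2·512^d` spheres on `𝕋³`), its time-windowed tube script, `TrackValid` from the tube calculus (T1)–(T5) with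
`stub_tubeNoContact`, `stub_reflectVelPerturbation`, `stub_contactPerturbation`, then `ignition_of_script` and the statics
(`sep`/`cost`/`packing` via `stub_packingOfSeparated`). -/
theorem stub_ignitionTemplates_assembly : IgnitionTemplates := by
  -- consumes the tube calculus (T1)–(T5) and the landed stub_tubeNoContact, stub_reflectVelPerturbation,
  -- stub_contactPerturbation, ignition_of_script, stub_packingOfSeparated
  have _h₁ := stub_tubeInv; have _h₂ := stub_tubeOutgoing; have _h₃ := stub_tubeNextPhase; have _h₄ := stub_tubeProg
  have _h₅ := stub_contactLate; have _h₆ := stub_contactWindow; have _h₈ := stub_torusDistChart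
  have _b₁ := @stub_bushSeparation
  sorry

/-- COMPOSITION: the target of the line. -/
theorem ignitionTemplates_of : IgnitionTemplates :=
  stub_ignitionTemplates_assembly

/-- … and hence the refutation of the crux (Phase 1, landed). -/
theorem not_influenceLocality_of : ¬ InfluenceLocality :=
  InfluenceLocality_false_of_IgnitionTemplates ignitionTemplates_of

end

end Summit.AtomisticToContinuum.HydrodynamicLimit.Theorems.InfluenceLocality.Negative
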